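import Summits.QuantumFields.YangMills.Theorems.BalabanUVNodesN15TwoSpacingGluingCurvedKnitCovariantLandauNodeSopRow
import Summits.QuantumFields.YangMills.Theorems.BalabanUVNodesN15CovariantLandauSopRowCTUniform
import HarnessLib

/-!
# THE GLUING STEP AT TWO LATTICE SPACINGS — PROGRAMME (P-S), XIV: NE2⁺ (OPERATOR LAYER) FOR THE GLUED FAMILY WITH BAŁABAN's FULLY COVARIANT SUMMAND LIVE, ALL FOUR FLAT ROWS OF THE
# LANDAU LETTER's PRIMITIVE FAMILY PROVED (King-model rung n15-c∕220 + Combes–Thomas n15-c∕222∕222b) — displayed now: per grid exactly ONE row, the covariant gradient difference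
# `D_TG′(T) − ∂G′(1)` ([B9] Thm 3.4), plus the two-grid η-defect row and entries 1–3 (dag-n15-c g23, n15-c∕223)

Cell `pub-ymgap`, seat `pub-ymgap-dag-n15-c` (R134 (a); HUMAN RULING D-0062), generation 23.  `bears_on: R4∕N15 · K3⁸ SpineGivenEndpointR13SepCoPHV (stmt-QuantumFields-27366)`.
Filed `--supports stmt-QuantumFields-27366 --as helper` — COUNT-NEUTRAL.  One theorem; 0 `sorry`.  Imports BY NAME n15-c∕221 (`ne2PlusOperator_sfqr_of_sopRow`), n15-c∕222b
(`CovLandau.flatSopRow_ct_uniform` on `a′ ∈ [1/2, 1]`), `King1986.aK_pos∕aK_le∕aK_ge`.  Nothing in the tree is modified.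

WHY.  n15-c∕221 displayed per grid the flat row of `S(1)⁻¹ = (Q′G′²Q′ᵀ)⁻¹(1)` at King's masses `a_K(1, L, K)·n^{d+1}`, `a_K ∈ [1 − L⁻², 1] ⊂ [1/2, 1]`; n15-c∕222b proves it there with
constants uniform in `a′ ∈ [1/2, 1]`, on every torus.  THIS FILE plugs it in: `NE2PlusOperator c₃₅ (sfInstance …) (sfqrFamily …)` from (`hE`) entries 1–3; (`hP`) per index and grid, for
class-(3.35) fields below a threshold, the ONE covariant gradient-difference row `D_TG′(T) − ∂G′(1) ≤ P₀·c₃₅L^mα₀·e^{−δd}` at King's mass ([Balaban1985BackgroundPropagators] Thm 3.4 shape —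
the Schauder-type estimate, the honest remaining covariant letter); (`hD`) the two-grid η-defect row of `N_V^R`.
* ★★★ **`ne2PlusOperator_sfqr_of_gradDiffRow`**.

HONEST FRAMING ∕ LIMITS.  Plumbing + dag-n15-e's King-model theorems + the T⁴ cell's Combes–Thomas kit (MODEL statements read on Bałaban's flat objects at `U ≡ 1` through exact
dictionaries); MODEL carriers (doubled-torus cover, global small-field gauge, one averaging level, unit weights, site transporters); the gradient-difference rows, the defect row and entries
1–3 are HYPOTHESES; NOT [Balaban1985BackgroundPropagators] Thm 3.1∕3.4∕3.14 as printed; NE2⁺ NOT PRINTED; N15 of record untouched (DISCHARGED AS CONSUMED, p687738); counts UNMOVED (typed 28∕28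
· discharged 8∕27); one finite 𝕋⁴ at fixed ε per index — NOT infinite volume ∕ OS ∕ mass gap ∕ Clay.  Restate-immune (no Theses import).
-/

noncomputable section

open scoped BigOperators Matrix

namespace Summit.QuantumFields.YangMills.BalabanUVNodes.N15.Gluing

open Literature.MathematicalPhysics.QuantumFieldTheory.Balaban1983to89
open Literature.MathematicalPhysics.QuantumFieldTheory.Balaban1983to89.B11SectG (BlockNorm HasMaj)
open Literature.MathematicalPhysics.QuantumFieldTheory.Balaban1983to89.T4EtaRateDefect (idef)
open Literature.MathematicalPhysics.QuantumFieldTheory.Balaban1983to89.T4EtaRateCoeffDefect (pull)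
open Literature.MathematicalPhysics.QuantumFieldTheory.Balaban1983to89.B6UnitTorusCarrier (unitTorusGeo unitTorusGeo_dist_nonneg)
open Literature.MathematicalPhysics.QuantumFieldTheory.Balaban1983to89.B5Prop11Plancherel (Tor fine)
open Literature.MathematicalPhysics.QuantumFieldTheory.Balaban1983to89.T4EtaRate (NE2PlusOperator rateFactor)
open Literature.MathematicalPhysics.QuantumFieldTheory.King1986 (aK aK_pos aK_le aK_ge)
open Literature.MathematicalPhysics.QuantumFieldTheory.King1986.Torus (blockOf tdistT)
open Literature.Barriers.QuantumFields (traceForm)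
open Summit.QuantumFields.YangMills.BalabanUVNodes.N15.BackgroundLayer (gavgM)
open Summit.QuantumFields.YangMills.BalabanUVNodes.N15.VectorPiece (kingPrV)
open Summit.QuantumFields.YangMills.BalabanUVNodes.N15.MatrixSpecies (liftBlk liftMap)
open Summit.QuantumFields.YangMills.BalabanUVNodes.N15.OperatorReadout (opGeo)
open Summit.QuantumFields.YangMills.BalabanUVNodes.N15.CovLandau (cgrad csavg cGreen cSop flatSopRow_ct_uniform)

variable {d : ℕ} {L : ℕ} [NeZero L]

section Node

open scoped Matrix.Norms.L2Operator

variable (d) (mm ι : Type) [Fintype mm] [DecidableEq mm] [Nonempty mm] [Fintype ι] [DecidableEq ι] (e : Matrix mm mm ℂ ≃L[ℝ] (ι → ℝ))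

/-- ★★★ **NE2⁺, OPERATOR LAYER, BY NAME, FOR THE GLUED FAMILY WITH BAŁABAN's FULLY COVARIANT SUMMAND LIVE — ALL FOUR FLAT ROWS PROVED.**  n15-c∕221 fed by n15-c∕222b on both grids at
King's masses; displayed: per grid the covariant gradient-difference row (`hP`), the two-grid η-defect row (`hD`), entries 1–3 (`hE`).  MODEL family; NOT [B9] Thm 3.1∕3.4∕3.14 as printed.
[cite: Balaban1985BackgroundPropagators, Thm 3.1 (3.42) p.397, (3.49) p.399, Thm 3.4 p.400, Thm 3.14 pp.426–427; Balaban1984PropagatorsII, Props. 2.2–2.3 pp.228–231; Balaban1983RegularityDecay, Theorem (1.10) p.573; King1986, Thm 3.3 p.656, Prop. 3.9 (3.73) p.665] -/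
theorem ne2PlusOperator_sfqr_of_gradDiffRow (hL : Odd L ∧ 1 < L) (hL7 : 7 ≤ L) {a : ℝ} (ha : 0 < a) {c35 : ℝ} (hc35 : 0 < c35) (he : ∀ A B : Matrix mm mm ℂ, traceForm A B = e A ⬝ᵥ e B)
    (E : ∀ i : SfIdx d L, Fin 4 → (Fin (d + 1) → CvX' d L i.m i.kk i.r hL → Matrix mm mm ℂ) → ((CvX d L i.m i.kk hL × ι → ℝ) →ₗ[ℝ] (CvX' d L i.m i.kk i.r hL × ι → ℝ)))
    (hE : ∃ M₁ δ₁ a₁ B₁ γ₁ : ℝ, 0 < M₁ ∧ 0 < δ₁ ∧ 0 < a₁ ∧ 0 < B₁ ∧ 0 < γ₁ ∧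
      ∀ i : SfIdx d L, M₁ ≤ (L : ℝ) ^ i.m → ∀ α₀ : ℝ, 0 < α₀ → (L : ℝ) ^ i.m * α₀ ≤ a₁ →
        ∀ A' : Fin (d + 1) → CvX' d L i.m i.kk i.r hL → Matrix mm mm ℂ, (sfInstance d mm ι hL i).Bf.Reg335 c35 α₀ A' → ∀ n : Fin 4, n ≠ 0 →
          HasMaj (BlockNorm.ofBlocks (sfGeo d hL i) (liftBlk (cvBlk d L i.m i.kk hL) ι))
            (BlockNorm.ofBlocks (sfGeo d hL i) (liftBlk (cvBlk d L i.m i.kk hL ∘ kingPrV L i.kk i.r (cvM d L i.m i.kk hL)) ι)) (E i n A')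
            (fun y y' => B₁ * B9.pref4 ((opGeo (sfGeo d hL i) (CvX d L i.m i.kk hL × ι) (liftBlk (cvBlk d L i.m i.kk hL) ι)).len y) n * Real.exp (-(δ₁ * (sfGeo d hL i).dist y y')) *
              max (rateFactor (opGeo (sfGeo d hL i) (CvX d L i.m i.kk hL × ι) (liftBlk (cvBlk d L i.m i.kk hL) ι)) γ₁ y)
                (rateFactor (opGeo (sfGeo d hL i) (CvX d L i.m i.kk hL × ι) (liftBlk (cvBlk d L i.m i.kk hL) ι)) γ₁ y')))
    (hP : ∃ δ₂ P0 aP : ℝ, 0 < δ₂ ∧ 0 ≤ P0 ∧ 0 < aP ∧ ∀ i : SfIdx d L,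
        ∀ α₀ : ℝ, 0 < α₀ → (L : ℝ) ^ i.m * α₀ ≤ aP → ∀ A' : Fin (d + 1) → CvX' d L i.m i.kk i.r hL → Matrix mm mm ℂ, (sfInstance d mm ι hL i).Bf.Reg335 c35 α₀ A' →
          HasMaj (BlockNorm.ofBlocks (unitTorusGeo L i.kk (cvM d L i.m i.kk hL)) (liftBlk (blockOf (L ^ i.kk) (cvM d L i.m i.kk hL)) ι)) (BlockNorm.ofBlocks (unitTorusGeo L i.kk (cvM d L i.m i.kk hL)) (liftBlk (fun b : Tor (fine (L ^ i.kk) (cvM d L i.m i.kk hL)) × Fin (d + 1) => blockOf (L ^ i.kk) (cvM d L i.m i.kk hL) b.1) ι)) (Matrix.mulVecLin (cgrad (cvM d L i.m i.kk hL) (L ^ i.kk) (cvT₀ e (fun μ x => NormedSpace.exp (((((L ^ i.kk : ℕ) : ℝ))⁻¹) • gavgM (Matrix mm mm ℂ) (Fin (d + 1)) (kingPrV L i.kk i.r (cvM d L i.m i.kk hL)) A' μ x))) * cGreen (cvM d L i.m i.kk hL) (L ^ i.kk) (cvT₀ e (fun μ x => NormedSpace.exp (((((L ^ i.kk : ℕ)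 : ℝ))⁻¹) • gavgM (Matrix mm mm ℂ) (Fin (d + 1)) (kingPrV L i.kk i.r (cvM d L i.m i.kk hL)) A' μ x))) (aK 1 (L : ℝ) i.kk * ((L ^ i.kk : ℕ) : ℝ) ^ (d + 1)) - cgrad (cvM d L i.m i.kk hL) (L ^ i.kk) (fun (_ : Fin (d + 1)) (_ : Tor (fine (L ^ i.kk) (cvM d L i.m i.kk hL))) => (1 : Matrix ι ι ℝ)) * cGreen (cvM d L i.m i.kk hL) (L ^ i.kk) (fun (_ : Fin (d + 1)) (_ : Tor (fine (L ^ i.kk) (cvM d L i.m i.kk hL))) => (1 : Matrix ι ι ℝ)) (aK 1 (L : ℝ) i.kk * ((L ^ i.kk : ℕ) : ℝ) ^ (d + 1)))) (fun y y' => P0 * (c35 * (L : ℝ) ^ i.m * α₀) * Real.exp (-(δ₂ * (unitTorusGeo L i.kk (cvM d L i.m i.kk hL)).dist y y'))) ∧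
          HasMaj (BlockNorm.ofBlocks (unitTorusGeo L i.kk (cvM d L i.m i.kk hL)) (liftBlk (blockOf (L ^ i.r * L ^ i.kk) (cvM d L i.m i.kk hL)) ι)) (BlockNorm.ofBlocks (unitTorusGeo L i.kk (cvM d L i.m i.kk hL)) (liftBlk (fun b : Tor (fine (L ^ i.r * L ^ i.kk) (cvM d L i.m i.kk hL)) × Fin (d + 1) => blockOf (L ^ i.r * L ^ i.kk) (cvM d L i.m i.kk hL) b.1) ι)) (Matrix.mulVecLin (cgrad (cvM d L i.m i.kk hL) (L ^ i.r * L ^ i.kk) (cvT₀ e (fun μ x' => NormedSpace.exp (((((L ^ i.r * L ^ i.kk : ℕ) : ℝ))⁻¹) • A' μ x'))) * cGreen (cvM d L i.m i.kk hL) (L ^ i.r * L ^ i.kk) (cvT₀ e (fun μ x' => NormedSpace.exp (((((L ^ i.r * L ^ i.kk : ℕ) : ℝ))⁻¹) • A' μ x'))) (aK 1 (L : ℝ) (i.r + i.kk) * ((L ^ i.r * L ^ i.kk : ℕ) : ℝ) ^ (d + 1)) - cgrad (cvM d L i.m i.kk hL) (L ^ i.r * L ^ i.kk) (fun (_ : Fin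 (d + 1)) (_ : Tor (fine (L ^ i.r * L ^ i.kk) (cvM d L i.m i.kk hL))) => (1 : Matrix ι ι ℝ)) * cGreen (cvM d L i.m i.kk hL) (L ^ i.r * L ^ i.kk) (fun (_ : Fin (d + 1)) (_ : Tor (fine (L ^ i.r * L ^ i.kk) (cvM d L i.m i.kk hL))) => (1 : Matrix ι ι ℝ)) (aK 1 (L : ℝ) (i.r + i.kk) * ((L ^ i.r * L ^ i.kk : ℕ) : ℝ) ^ (d + 1)))) (fun y y' => P0 * (c35 * (L : ℝ) ^ i.m * α₀) * Real.exp (-(δ₂ * (unitTorusGeo L i.kk (cvM d L i.m i.kk hL)).dist y y'))))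
    (hD : ∃ δD CR γR aD : ℝ, 0 < δD ∧ 0 ≤ CR ∧ 0 < γR ∧ 0 < aD ∧
      ∀ i : SfIdx d L, ∀ α₀ : ℝ, 0 < α₀ → (L : ℝ) ^ i.m * α₀ ≤ aD → ∀ A' : Fin (d + 1) → CvX' d L i.m i.kk i.r hL → Matrix mm mm ℂ, (sfInstance d mm ι hL i).Bf.Reg335 c35 α₀ A' →
        HasMaj (CvNorm d L i.m i.kk hL ι) (BlockNorm.ofBlocks (unitTorusGeo L i.kk (cvM d L i.m i.kk hL)) (liftBlk (cvBlk d L i.m i.kk hL ∘ (kingPrV L i.kk i.r (cvM d L i.m i.kk hL))) ι)) (idef (pull (liftMap (kingPrV L i.kk i.r (cvM d L i.m i.kk hL)) ι)) (pull (liftMap (kingPrV L i.kk i.r (cvM d L i.m i.kk hL)) ι)) (cvNVr' d L i.m i.kk i.r hL a ι e (fun μ x' => NormedSpace.exp (((((L ^ i.r * L ^ i.kk : ℕ) : ℝ))⁻¹) • A' μ x'))) (cvNVr d L i.m i.kk hL a ι e (fun μ x => NormedSpace.exp (((((L ^ i.kk : ℕ) : ℝ))⁻¹) • gavgM (Matrix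 mm mm ℂ) (Fin (d + 1)) (kingPrV L i.kk i.r (cvM d L i.m i.kk hL)) A' μ x)))) (fun y y' => (CR * ((L : ℝ) ^ i.kk) ^ (-γR)) * Real.exp (-(δD * (unitTorusGeo L i.kk (cvM d L i.m i.kk hL)).dist y y')))) :
    NE2PlusOperator c35 (sfInstance d mm ι hL) (fun i => sfqrFamily d mm ι a e hL i (E i)) := by
  have hL2 : 2 ≤ L := le_trans (by norm_num) hL7
  have hL1r : (1 : ℝ) < (L : ℝ) := by exact_mod_cast hL.2
  have hLr : (0 : ℝ) < (L : ℝ) := by linarith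
  have hL2r : (2 : ℝ) ≤ (L : ℝ) := by exact_mod_cast hL2
  obtain ⟨CS, δS, hCS, hδS, HS⟩ := flatSopRow_ct_uniform (d := d) L (a₁ := (1 / 2 : ℝ)) (a₂ := (1 : ℝ)) (by norm_num) (by norm_num)
  obtain ⟨δ₂, P0, aP, hδ₂, hP0, haP, hP⟩ := hP
  -- King's masses lie in `[1/2, 1]`
  have haKlo : ∀ K : ℕ, 1 ≤ K → (1 / 2 : ℝ) ≤ aK 1 (L : ℝ) K := fun K hK => by
    have h1 := aK_ge one_pos hL1r hK (a := (1 : ℝ))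
    have hL4 : (4 : ℝ) ≤ (L : ℝ) ^ 2 := by nlinarith
    have hinv : ((L : ℝ) ^ 2)⁻¹ ≤ 1 / 4 := by rw [one_div]; exact inv_anti₀ (by norm_num) hL4
    linarith
  refine ne2PlusOperator_sfqr_of_sopRow d mm ι e hL hL7 ha hc35 he E hE
    ⟨min δS δ₂, CS, P0, aP, lt_min hδS hδ₂, hCS.le, hP0, haP, fun i => ?_⟩ hD
  have hK1 : 1 ≤ i.kk := i.one_le
  have hK2 : 1 ≤ i.r + i.kk := hK1.trans (Nat.le_add_left _ _)
  have hd0 := unitTorusGeo_dist_nonneg L i.kk (cvM d L i.m i.kk hL)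
  have hSc := HS (aK 1 (L : ℝ) i.kk) (haKlo i.kk hK1) (aK_le one_pos hL1r hK1) (cvM d L i.m i.kk hL) (L ^ i.kk) i.kk ι
  have hSf := HS (aK 1 (L : ℝ) (i.r + i.kk)) (haKlo (i.r + i.kk) hK2) (aK_le one_pos hL1r hK2) (cvM d L i.m i.kk hL) (L ^ i.r * L ^ i.kk) i.kk ι
  have hNc : (0 : ℝ) ≤ CS * ((L ^ i.kk : ℕ) : ℝ) ^ (d + 1) := by positivity
  have hNf : (0 : ℝ) ≤ CS * ((L ^ i.r * L ^ i.kk : ℕ) : ℝ) ^ (d + 1) := by positivity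
  refine ⟨hSc.of_rate_le hd0 hNc (min_le_left _ _), hSf.of_rate_le hd0 hNf (min_le_left _ _), fun α₀ hα₀ hMa A' hA' => ?_⟩
  obtain ⟨hPc, hPf⟩ := hP i α₀ hα₀ hMa A' hA'
  have hr0 : 0 ≤ P0 * (c35 * (L : ℝ) ^ i.m * α₀) := by positivity
  exact ⟨hPc.of_rate_le hd0 hr0 (min_le_right _ _), hPf.of_rate_le hd0 hr0 (min_le_right _ _)⟩

end Node

end Summit.QuantumFields.YangMills.BalabanUVNodes.N15.Gluing

end
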